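/-
Copyright (c) 2026. All rights reserved.
Released under Apache 2.0 license as described in the file LICENSE.
Authors: abc-iut cell, block F seat abc-iut-f-168 (gen 2).
-/
import Literature.AnabelianGeometry.SemiGraphs.TemperedOriginGenuineNonVacuity
import Literature.AnabelianGeometry.SemiGraphs.TemperedAbsoluteness
import Literature.AnabelianGeometry.SemiGraphs.TemperedCurveHyperbolicWitness
import Literature.AnabelianGeometry.AbsoluteAnabelian.MLFSlimKummerProofs
import HarnessLib

/-!
# [SemiAnbd] §6 at a datum of PUNCTURED-DISC TYPE: Thm. 6.5 (iii) (`IsoPreservesCuspidalDecomp`) HOLDS at a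
# cusped datum, and all five `TemperedOrigin.…Holds` hold together at a certificate certifying a CUSP

Mochizuki, *Semi-graphs of anabelioids*, Publ. RIMS **42** (2006) [SemiAnbd], §6 pp. 69–72 (author's ms.):
Lem. 6.1 (Profinite Normalizers), Lem. 6.3 (Dense Subgroups), Thm. 6.5 (Tempered Decomposition Groups)
(i)–(iv), Thm. 6.6 (Tempered and Profinite Outer Isomorphisms) — typed by abc-iut-L3-t2 in
`TemperedAnabelian.lean` as predicates on the interface `TemperedCurve p` and bundled over origin
certificates in `TemperedOrigin.lean` (FACT-LIST rows F-1704 `CuspidalAbsolutenessHolds` = Thm. 6.5 (iii),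
F-1705, F-1706, F-1707, F-1708). [cite: MochizukiSemiAnbd2006, §6 pp.69-72]

PROOF-ONLY non-vacuity file (abc-iut cell, NV lane, self-named row «NV-L3 THM65iii-CUSPED», seat
abc-iut-f-168 gen 2; no `def`, no `instance`, nothing of the frozen interface restated).

STATE OF THE NV COLUMN BEFORE THIS FILE.  Thm. 6.5 (iii) AS TYPED — "every isomorphism of tempered groups
`α : Π^temp_{X_K} ≅ Π^temp_{Y_L}` preserves cuspidal decomposition groups and cuspidal geometric decomposition
groups", quantified over ALL continuous isomorphisms — had NO model witness at a datum with a cusp: it is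
vacuous at `TemperedCurve.degenerate` (no closed points) and it FAILS at abc-iut-w5-d040's genuine-arithmetic
datum `G_{ℚ_p} × F̂₂` (`TemperedCurveThm65iiiNegative.lean`: the swap `a ↔ b` moves `cl⟨a⟩`).  The obstacle
is real: at any datum the quantifier ranges over automorphisms of a group containing the opaque profinite
group `G_K`, so a positive instance needs an AUTOMORPHISM-INVARIANT description of `D_x` and of `I_x`.

THE DATUM OF PUNCTURED-DISC TYPE (`TemperedCurve.exists_puncturedDisc`).  `K := ℚ_p`,
`Π^temp := G_{ℚ_p} × Ẑ` (compact, its own profinite completion), ONE closed point `x`, a `K`-rational CUSP,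
with `D_x := Π^temp` and hence `I_x = D_x ∩ Δ^temp = 1 × Ẑ`.  The shape is that of the fundamental group of a
punctured formal disc over `K` (`Ẑ(1) ⋊ G_K` with `D_x` everything; here with trivial twist).
KEY INPUT: `I_x = Z(Π^temp)` — because `Z(G_{ℚ_p}) = 1`, which is the tree's UNCONDITIONAL theorem
`galoisMLF_slim_holds` ([AbsAnab] Thm. 1.1.1 (ii), "`G_K` is slim", `MLFSlimKummerProofs.lean`, abc-iut-L4)
applied to the open subgroup `G_{ℚ_p}` itself (`center_GQp_eq_bot`).  Consequently BOTH `D_x = Π` and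
`I_x = Z(Π)` are CHARACTERISTIC, and:

* `TemperedCurve.isoPreservesCuspidalDecomp_of_disc` — **Thm. 6.5 (iii) AS TYPED holds** between any two
  data of punctured-disc type (every cusp has `D = Π`, `I = Z(Π)`), for EVERY continuous isomorphism;
* `decompCommensurablyTerminal_of_decomp_eq_top`, `decompEqCommensuratorOfOpenInertia_of_disc` — Thm. 6.5
  (ii) both sentences (`C_Π(Π) = Π`; a subgroup of the centre is normal, so `C_Π(H) = Π = D_x`);
* `TemperedOrigin.exists_principal_cusped_allHolds` — at the PRINCIPAL certificate of the punctured-disc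
  datum (which certifies a datum WITH a rational cusp) ALL FIVE typed §6 statements
  `ProfiniteNormalizersHolds` (Lem. 6.1), `DenseSubgroupsHolds` (Lem. 6.3), `ProfiniteOuterIsoLiftsHolds`
  (Thm. 6.6), `TemperedDecompositionGroupsHolds` (Thm. 6.5 (i)(ii)(iv)) AND `CuspidalAbsolutenessHolds`
  (Thm. 6.5 (iii)) hold SIMULTANEOUSLY (the first three by abc-iut-w6-d055's compact-regime lemmas,
  `TemperedOriginGenuineNonVacuity.lean`, consumed by name).

HONEST LIMITS.  Consistency evidence for the typing only: `Δ^temp = Ẑ` is ABELIAN (so the datum is not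
"hyperbolic": `Π^temp` is not slim, `DLocObj` / `GroupLevelData` are not claimed), `D_x = Π^temp` (one closed
point), `Π^temp` is compact; Thm. 6.5 (i)/(iv) hold for the trivial reason that there is one closed point.  It
is NOT André's `π₁^temp` of a hyperbolic curve, and nothing printed in [SemiAnbd] is asserted; no side is
taken on [IUTchIII] Cor. 3.12; a model witness is not an endorsement.
-/

noncomputable section

namespace Literature.AnabelianGeometry.SemiGraphs

open scoped Pointwise
open _root_.Topology
open Literature.AlgebraicGeometry.Frobenioids (IsSlimGroup)
open Literature.AnabelianGeometry.AbsoluteAnabelian (galoisMLF_slim_holds)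

universe u v

/-! ### 1. Centres: transport along isomorphisms; `Z(G_{ℚ_p}) = 1`; `Z(G × A)`; `Ẑ` is commutative -/

section Center

variable {G : Type u} {H : Type v} [Group G] [Group H]

/-- An isomorphism of groups carries the centre ONTO the centre. [folklore] -/
private theorem map_center_eq_center_of_mulEquiv (e : G ≃* H) :
    (Subgroup.center G).map e.toMonoidHom = Subgroup.center H := by
  apply le_antisymm
  · rintro _ ⟨z, hz, rfl⟩
    rw [SetLike.mem_coe, Subgroup.mem_center_iff] at hz
    rw [Subgroup.mem_center_iff]
    intro h
    obtain ⟨g, rfl⟩ := e.surjective h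
    change e g * e z = e z * e g
    rw [← map_mul, ← map_mul, hz g]
  · intro h hh
    refine ⟨e.symm h, ?_, e.apply_symm_apply h⟩
    rw [Subgroup.mem_center_iff] at hh
    rw [SetLike.mem_coe, Subgroup.mem_center_iff]
    intro g
    apply e.injective
    rw [map_mul, map_mul, e.apply_symm_apply]
    exact hh (e g)

/-- A normal subgroup has commensurator the whole group. [folklore] -/
private theorem commensurator_eq_top_of_normal (K : Subgroup G) (hN : K.Normal) :
    Subgroup.Commensurable.commensurator K = ⊤ := by
  refine eq_top_iff.2 fun g _ => ?_
  simpa only [Subgroup.Commensurable.commensurator_mem_iff, hN.conjAct] using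
    Subgroup.Commensurable.refl K

/-- A subgroup contained in the centre is normal. [folklore] -/
private theorem normal_of_le_center (K : Subgroup G) (hK : K ≤ Subgroup.center G) : K.Normal :=
  ⟨fun k hk g => by
    have hc : g * k = k * g := Subgroup.mem_center_iff.1 (hK hk) g
    rw [hc, mul_inv_cancel_right]
    exact hk⟩

/-- In `G × A` with `Z(G) = 1` and `A` commutative the centre is `1 × A`. [folklore] -/
private theorem center_prod_eq_bot_prod_top {A : Type v} [Group A] (hG : Subgroup.center G = ⊥)
    (hA : ∀ a b : A, a * b = b * a) :
    Subgroup.center (G × A) = (⊥ : Subgroup G).prod ⊤ := by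
  have hZA : Subgroup.center A = ⊤ :=
    eq_top_iff.2 fun a _ => Subgroup.mem_center_iff.2 fun b => hA b a
  rw [Subgroup.center_prod, hG, hZA]

end Center

/-- **`Z(G_{ℚ_p}) = 1`**: the centre of `G_{ℚ_p} = Gal(ℚ̄_p/ℚ_p)` is trivial — from the tree's UNCONDITIONAL
theorem `galoisMLF_slim_holds` ([AbsAnab] Thm. 1.1.1 (ii): the absolute Galois group of an MLF is slim),
applied to the open subgroup `G_{ℚ_p}` itself. [cite: MochizukiAbsAnab2004, Thm 1.1.1 (ii) p.6] -/
theorem center_GQp_eq_bot (p : ℕ) [Fact p.Prime] : Subgroup.center (GQp p) = ⊥ := by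
  have h : IsSlimGroup (Field.absoluteGaloisGroup ℚ_[p]) := galoisMLF_slim_holds p ℚ_[p]
  have h1 := h.centralizer_eq_bot ⊤ isOpen_univ
  have h2 : Subgroup.center (Field.absoluteGaloisGroup ℚ_[p]) = ⊥ := by
    rw [eq_bot_iff, ← h1]
    intro z hz
    exact Subgroup.mem_centralizer_iff.2 fun g _ => Subgroup.mem_center_iff.1 hz g
  exact h2

/-- `Ẑ` (the profinite completion of `ℤ`) is commutative: componentwise in its finite quotients. [folklore] -/
private theorem zHat_mul_comm (a b : ZHat) : a * b = b * a := by
  apply Subtype.ext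
  funext N
  change a.val N * b.val N = b.val N * a.val N
  have key : ∀ x y : Multiplicative ℤ ⧸ N.toSubgroup, x * y = y * x := fun x y => _root_.mul_comm x y
  exact key _ _

/-- `Z(G_{ℚ_p} × Ẑ) = 1 × Ẑ`. [cite: MochizukiAbsAnab2004, Thm 1.1.1 (ii) p.6] -/
theorem center_GQp_prod_zHat (p : ℕ) [Fact p.Prime] :
    Subgroup.center (GQp p × ZHat) = (⊥ : Subgroup (GQp p)).prod ⊤ :=
  center_prod_eq_bot_prod_top (center_GQp_eq_bot p) zHat_mul_comm

/-! ### 2. Data of punctured-disc type: Thm. 6.5 AS TYPED -/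

namespace TemperedCurve

variable {p : ℕ} [Fact p.Prime]

/-- **[SemiAnbd] Thm. 6.5 (iii) AS TYPED (`IsoPreservesCuspidalDecomp`) between data of punctured-disc type.**
If every cusp `x` of `X` has `D_x = Π^temp_{X_K}` and `I_x = Z(Π^temp_{X_K})`, and `Y` has a cusp `y` with
`D_y = Π^temp_{Y_L}`, `I_y = Z(Π^temp_{Y_L})`, then EVERY isomorphism of topological groups
`α : Π^temp_{X_K} ≅ Π^temp_{Y_L}` carries cuspidal decomposition groups (all `= Π`) to cuspidal decomposition
groups and cuspidal geometric decomposition groups (all `= Z(Π)`, a characteristic subgroup) to cuspidal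
geometric decomposition groups. [cite: MochizukiSemiAnbd2006, Thm 6.5(iii) p.72] -/
theorem isoPreservesCuspidalDecomp_of_disc (X Y : TemperedCurve p)
    (hX : ∀ x, X.IsCusp x → X.decomp x = ⊤ ∧ X.inertia x = Subgroup.center X.PiTemp)
    {y : Y.Pt} (hy : Y.IsCusp y) (hDy : Y.decomp y = ⊤) (hIy : Y.inertia y = Subgroup.center Y.PiTemp) :
    X.IsoPreservesCuspidalDecomp Y := by
  intro α D
  refine ⟨?_, ?_⟩
  · rintro ⟨x, hx, γ, rfl⟩
    refine ⟨y, hy, 1, ?_⟩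
    rw [(hX x hx).1, (inferInstance : (⊤ : Subgroup X.PiTemp).Normal).conjAct γ,
      Subgroup.map_top_of_surjective α.toMulEquiv.toMonoidHom α.toMulEquiv.surjective, one_smul, hDy]
  · rintro ⟨x, hx, γ, rfl⟩
    refine ⟨y, hy, 1, ?_⟩
    rw [(hX x hx).2, (inferInstance : (Subgroup.center X.PiTemp).Normal).conjAct γ,
      map_center_eq_center_of_mulEquiv α.toMulEquiv, one_smul, hIy]

/-- **Thm. 6.5 (ii), first sentence, AS TYPED** when every `D_x = Π^temp`: `C_Π(Π) = Π`.
[cite: MochizukiSemiAnbd2006, Thm 6.5(ii) p.71] -/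
theorem decompCommensurablyTerminal_of_decomp_eq_top (X : TemperedCurve p) (hD : ∀ x, X.decomp x = ⊤) :
    X.DecompCommensurablyTerminal := by
  intro x
  rw [hD x]
  exact commensurator_eq_top_of_normal ⊤ inferInstance

/-- **Thm. 6.5 (ii), second sentence, AS TYPED** at a datum of punctured-disc type: for a cusp `x` with
`D_x = Π^temp`, `I_x = Z(Π^temp)` and ANY subgroup `H ⊆ I_x` (open or not), `C_Π(H) = Π = D_x` — a subgroup
of the centre is normal. [cite: MochizukiSemiAnbd2006, Thm 6.5(ii) p.71] -/
theorem decompEqCommensuratorOfOpenInertia_of_disc (X : TemperedCurve p)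
    (hX : ∀ x, X.IsCusp x → X.decomp x = ⊤ ∧ X.inertia x = Subgroup.center X.PiTemp) :
    X.DecompEqCommensuratorOfOpenInertia := by
  intro x hx H hH _
  obtain ⟨hD, hI⟩ := hX x hx
  rw [hD]
  exact commensurator_eq_top_of_normal H (normal_of_le_center H (hI ▸ hH))

/-- Thm. 6.5 (i) AS TYPED at a datum with at most one closed point (trivially).
[cite: MochizukiSemiAnbd2006, Thm 6.5(i) p.71] -/
theorem decompDeterminesPoint_of_subsingleton (X : TemperedCurve p) [Subsingleton X.Pt] :
    X.DecompDeterminesPoint := fun _ _ _ => Subsingleton.elim _ _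

/-- Thm. 6.5 (i), cusp clause, AS TYPED at a datum with at most one closed point (trivially).
[cite: MochizukiSemiAnbd2006, Thm 6.5(i) p.71] -/
theorem inertiaDeterminesCusp_of_subsingleton (X : TemperedCurve p) [Subsingleton X.Pt] :
    X.InertiaDeterminesCusp := fun _ _ _ _ => Subsingleton.elim _ _

/-- Thm. 6.5 (iv) AS TYPED at a datum all of whose closed points are cusps (vacuously).
[cite: MochizukiSemiAnbd2006, Thm 6.5(iv) p.72] -/
theorem noncuspidalNotLeCuspidal_of_forall_isCusp (X : TemperedCurve p) (h : ∀ x, X.IsCusp x) :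
    X.NoncuspidalNotLeCuspidal := fun x _ hx _ _ _ _ => hx (h x)

/-! ### 3. The datum of punctured-disc type exists (slimness of `G_{ℚ_p}`) -/

/-- **A §6 datum of PUNCTURED-DISC TYPE exists.**  `K := ℚ_p`, `Π^temp := G_{ℚ_p} × Ẑ` (compact, its own
profinite completion, `aug := pr₁` onto `G_{ℚ_p}`), ONE closed point — a `K`-rational CUSP — with
`D_x := Π^temp`
and `I_x = 1 × Ẑ ≃ Ẑ`, which is the CENTRE of `Π^temp` because `Z(G_{ℚ_p}) = 1` (`galoisMLF_slim_holds`).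
Recorded: `X.K = ⊥`, `aug` onto, `Π^temp` compact, `ι : Π^temp → Π̂` bijective, exactly one closed point, every
closed point a rational cusp with `D_x = ⊤` and `I_x = Z(Π^temp)`, `Δ^temp` commutative (HONEST: abelian, not
hyperbolic), and the splitting `G_{ℚ_p} × 1` of `1 → I_x → D_x → G_K → 1` ([Mzk8] §4).
[cite: MochizukiSemiAnbd2006, §6 pp.69-71] -/
theorem exists_puncturedDisc (p : ℕ) [Fact p.Prime] :
    ∃ X : TemperedCurve p,
      X.K = ⊥ ∧ Function.Surjective X.aug ∧ CompactSpace X.PiTemp ∧ Function.Bijective X.toHat ∧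
      Nonempty X.Pt ∧ Subsingleton X.Pt ∧ (∀ x, X.IsCusp x) ∧ (∀ x, X.IsRationalPt x) ∧
      (∀ x, X.decomp x = ⊤) ∧ (∀ x, X.inertia x = Subgroup.center X.PiTemp) ∧
      (∀ a b : X.DeltaTemp, a * b = b * a) ∧
      (∀ x, ∃ S, X.IsSplittingSubgroup x S) := by
  classical
  haveI : IsGalois ℚ_[p] (AlgebraicClosure ℚ_[p]) := {}
  haveI : T2Space (GQp p) := krullTopology_t2
  let X : TemperedCurve p :=
    { K := ⊥
      finiteDimensional_K := inferInstance
      PiTemp := GQp p × ZHat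
      aug := ContinuousMonoidHom.fst _ _
      range_aug := by
        rw [IntermediateField.fixingSubgroup_bot]
        exact MonoidHom.range_eq_top.mpr Prod.fst_surjective
      PiHat := GQp p × ZHat
      toHat := ContinuousMonoidHom.id _
      isProfiniteCompletion_toHat := isProfiniteCompletion_id _
      toHat_injective := Function.injective_id
      augHat := ContinuousMonoidHom.fst _ _
      augHat_comp := fun _ => rfl
      Pt := Unit
      IsCusp := fun _ => True
      decomp := fun _ => ⊤
      isClosed_decomp := fun _ => by
        rw [Subgroup.coe_top]
        exact isClosed_univ
      isOpen_aug_decomp := fun _ => by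
        have h : (ContinuousMonoidHom.fst (GQp p) ZHat) '' ((⊤ : Subgroup (GQp p × ZHat)) : Set _) =
            Set.univ := by
          rw [Subgroup.coe_top, Set.image_univ, Set.range_eq_univ]
          exact Prod.fst_surjective
        rw [h]
        exact isOpen_univ
      inertia_eq_bot := fun _ h => (h trivial).elim
      inertia_equiv_zHat := fun _ _ =>
        ⟨{ toFun := fun x => x.1.2
           invFun := fun z =>
             ⟨(1, z), Subgroup.mem_inf.2 ⟨Subgroup.mem_top _, (MonoidHom.mem_ker).2 rfl⟩⟩
           left_inv := fun x => by
             obtain ⟨⟨g, z⟩, hx⟩ := x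
             have hg : g = 1 := (MonoidHom.mem_ker).1 (Subgroup.mem_inf.1 hx).2
             subst hg
             rfl
           right_inv := fun _ => rfl
           map_mul' := fun _ _ => rfl
           continuous_toFun := by fun_prop
           continuous_invFun := by fun_prop }⟩ }
  have hD : ∀ x, X.decomp x = ⊤ := fun _ => rfl
  have hΔ : X.DeltaTemp = (⊥ : Subgroup (GQp p)).prod ⊤ := by
    change (MonoidHom.fst (GQp p) ZHat).ker = _
    exact MonoidHom.ker_fst
  have hI : ∀ x, X.inertia x = Subgroup.center X.PiTemp := fun x => by
    change X.decomp x ⊓ X.DeltaTemp = Subgroup.center (GQp p × ZHat)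
    rw [hD, top_inf_eq, hΔ, center_GQp_prod_zHat]
  refine ⟨X, rfl, Prod.fst_surjective, (inferInstance : CompactSpace (GQp p × ZHat)),
    Function.bijective_id, ⟨()⟩, (inferInstance : Subsingleton Unit), fun _ => trivial, ?_, hD, hI, ?_, ?_⟩
  · -- the cusp is `K`-rational: `D_x = Π` surjects onto `G_K = G_{ℚ_p}`
    intro x g _
    exact ⟨(g, 1), Subgroup.mem_top _, rfl⟩
  · -- `Δ^temp = 1 × Ẑ` is commutative
    rintro ⟨⟨g, z⟩, hg⟩ ⟨⟨g', z'⟩, hg'⟩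
    have h1 : g = 1 := (MonoidHom.mem_ker).1 hg
    have h1' : g' = 1 := (MonoidHom.mem_ker).1 hg'
    subst h1 h1'
    exact Subtype.ext (Prod.ext rfl (zHat_mul_comm z z'))
  · -- the splitting `G_{ℚ_p} × 1` of `1 → I_x → D_x → G_K → 1`
    intro x
    refine ⟨(⊤ : Subgroup (GQp p)).prod ⊥, ?_, le_top, ?_, ?_⟩
    · change IsClosed (((⊤ : Subgroup (GQp p)).prod (⊥ : Subgroup ZHat) : Subgroup (GQp p × ZHat)) :
          Set (GQp p × ZHat))
      have h : (((⊤ : Subgroup (GQp p)).prod (⊥ : Subgroup ZHat) : Subgroup (GQp p × ZHat)) :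
          Set (GQp p × ZHat)) = (fun g : GQp p × ZHat => g.2) ⁻¹' {1} := by
        ext g
        simp [Subgroup.mem_prod]
      rw [h]
      exact isClosed_singleton.preimage (by fun_prop)
    · rw [hI x]
      change ((⊤ : Subgroup (GQp p)).prod (⊥ : Subgroup ZHat) : Subgroup (GQp p × ZHat)) ⊓
          Subgroup.center (GQp p × ZHat) = ⊥
      rw [center_GQp_prod_zHat, (Subgroup.eq_bot_iff_forall _)]
      intro g hg
      obtain ⟨h1, h2⟩ := Subgroup.mem_inf.1 hg
      exact Prod.ext ((Subgroup.mem_prod.1 h2).1) ((Subgroup.mem_prod.1 h1).2)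
    · rw [hI x, hD x]
      change ((⊤ : Subgroup (GQp p)).prod (⊥ : Subgroup ZHat) : Subgroup (GQp p × ZHat)) ⊔
          Subgroup.center (GQp p × ZHat) = ⊤
      rw [center_GQp_prod_zHat, eq_top_iff]
      rintro ⟨g, z⟩ -
      have hsplit : ((g, z) : GQp p × ZHat) = (g, 1) * (1, z) := by simp
      rw [hsplit]
      exact Subgroup.mul_mem_sup (Subgroup.mem_prod.2 ⟨Subgroup.mem_top _, Subgroup.mem_bot.2 rfl⟩)
        (Subgroup.mem_prod.2 ⟨Subgroup.mem_bot.2 rfl, Subgroup.mem_top _⟩)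

end TemperedCurve

/-! ### 4. All five typed §6 statements of `TemperedOrigin` at the principal certificate of a CUSPED datum -/

/-- **All five `TemperedOrigin.…Holds` statements (F-1704 – F-1708) hold SIMULTANEOUSLY at a certificate that
certifies a datum WITH A `K`-RATIONAL CUSP**: the principal certificate `Ω := ⟨(· = X)⟩` of the datum of
punctured-disc type.  Lem. 6.1 (ii)(iii) `ProfiniteNormalizersHolds`, Lem. 6.3 (ii)(iii) `DenseSubgroupsHolds`,
Thm. 6.6 `ProfiniteOuterIsoLiftsHolds` come from the compact regime (abc-iut-w6-d055's
`holds_principal_of_compactSpace`); Thm. 6.5 (i)(ii)(iv) `TemperedDecompositionGroupsHolds` and **Thm. 6.5 (iii)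
`CuspidalAbsolutenessHolds`** from §2.  HONEST: toy datum (abelian `Δ^temp`, `D_x = Π^temp`), consistency
evidence for the joint typing, not a model of a hyperbolic curve. [cite: MochizukiSemiAnbd2006, §6 pp.69-72] -/
theorem TemperedOrigin.exists_principal_cusped_allHolds (p : ℕ) [Fact p.Prime] :
    ∃ (X : TemperedCurve p) (Ω : TemperedOrigin p),
      (∀ Y, Ω.IsHyperbolicCurveOrigin Y ↔ Y = X) ∧
      (∃ x : X.Pt, X.IsCusp x ∧ X.IsRationalPt x) ∧ X.K = ⊥ ∧ CompactSpace X.PiTemp ∧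
      (∀ x, X.IsCusp x ∧ X.decomp x = ⊤ ∧ X.inertia x = Subgroup.center X.PiTemp) ∧
      Ω.ProfiniteNormalizersHolds ∧ Ω.DenseSubgroupsHolds ∧ Ω.ProfiniteOuterIsoLiftsHolds ∧
      Ω.TemperedDecompositionGroupsHolds ∧ Ω.CuspidalAbsolutenessHolds := by
  obtain ⟨X, hK, -, hcpt, -, ⟨x₀⟩, hsub, hcusp, hrat, hD, hI, -, -⟩ := TemperedCurve.exists_puncturedDisc p
  haveI := hcpt
  haveI := hsub
  obtain ⟨h61, h63, h66⟩ := X.holds_principal_of_compactSpace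
  refine ⟨X, ⟨fun Y => Y = X⟩, fun Y => Iff.rfl, ⟨x₀, hcusp x₀, hrat x₀⟩, hK, hcpt,
    fun x => ⟨hcusp x, hD x, hI x⟩, h61, h63, h66, ?_, ?_⟩
  · exact X.temperedDecompositionGroupsHolds_principal_iff.2
      ⟨X.decompDeterminesPoint_of_subsingleton, X.inertiaDeterminesCusp_of_subsingleton,
        X.decompCommensurablyTerminal_of_decomp_eq_top hD,
        X.decompEqCommensuratorOfOpenInertia_of_disc fun x _ => ⟨hD x, hI x⟩,
        X.noncuspidalNotLeCuspidal_of_forall_isCusp hcusp⟩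
  · exact X.cuspidalAbsolutenessHolds_principal_iff.2
      (X.isoPreservesCuspidalDecomp_of_disc X (fun x _ => ⟨hD x, hI x⟩) (hcusp x₀) (hD x₀) (hI x₀))

end Literature.AnabelianGeometry.SemiGraphs

end
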